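import Summits.Ventures.Crystal3D.StatusLinks
import Summits.Ventures.Crystal3D.LocalLP.BezdekConjecture
import Literature.Geometry.DiscreteGeometry.ExposedSurfaceIsoperimetric
import Literature.Geometry.DiscreteGeometry.SphericalIsoperimetricProof
import HarnessLib

/-!
# The isoperimetric input `(I)` from Federer's inequality, and the resulting trust bases

HONEST FRAMING. Part of the venture `Summits/Ventures/Crystal3D` (cell `pub-crystal3d`). This file
DERIVES the named input `IsoInput r (1/(4r²))` of `LocalLP/SurfaceComposition.lean` (for every
probing radius `r ≥ 1/2`) from ONE Literature named fact,
`Literature.Geometry.DiscreteGeometry.Federer1969_isoperimetricUnionBalls` (the isoperimetric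
inequality `36π vol(U)² ≤ area(∂U)³` for finite unions of closed balls in `ℝ³`, Federer 3.2.43;
NOT proved in the tree), through the writer's proved corollary
`Federer1969_isoperimetricUnionBalls.sphereFraction_sum_cube` (`ExposedSurfaceIsoperimetric.lean`:
the boundary of the union lies in the exposed directions, `μHE[2] = 4π · sphereFraction` on `S²`,
the disjoint half-balls give the volume). The venture's `exposedFraction x r i` is by `rfl` the
`sphereFraction` of the writer's `exposedDirections x r i`.

Consequences (all CONDITIONAL on classical named facts only, plus — for H1 — the cell's certified
CELL5 table as the cap input):
* `surfaceBound_levy_classical : Schmidt1948… → Federer1969… → SurfaceBound (167/100)` — the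
  rung `C < 6N - 1.67 N^{2/3}` now rests on exactly two classical theorems of the literature
  (Lévy–Schmidt on `S²`, Federer's isoperimetric inequality) and kernel-checked mathematics.
* `surfaceBound_H1_classical : LevyCapInput 1 FH1 → Federer1969… → SurfaceBound (23/10)`.
No crystallization statement is claimed.
-/

noncomputable section

open scoped BigOperators
open Real Finset

namespace Summit.Ventures.Crystal3D

open Literature.Geometry.DiscreteGeometry (sphereFraction exposedDirections
  Federer1969_isoperimetricUnionBalls Schmidt1948_sphericalIsoperimetric sphereFraction_nonneg
  Schmidt1948_sphericalIsoperimetric_holds)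

variable {N : ℕ}

/-- The venture's exposed fraction IS the writer's `sphereFraction (exposedDirections …)`. -/
theorem exposedFraction_eq_sphereFraction (x : Fin N → EuclideanSpace ℝ (Fin 3)) (r : ℝ)
    (i : Fin N) : exposedFraction x r i = sphereFraction (exposedDirections x r i) :=
  rfl

/-- **`(I)` from Federer.** Under Federer's isoperimetric inequality for unions of balls, every
packing of `N` diameter-`1` balls in `ℝ³` has total exposed fraction at probing radius
`r ≥ 1/2` at least `N^{2/3} / (4 r²)` (the `N` disjoint balls of radius `1/2` give
`vol ≥ N π/6`, so `area ≥ (36π)^{1/3} (Nπ/6)^{2/3} = π N^{2/3}`, a fraction `1/(4r²)` of the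
probing sphere's `4π r²` per `N^{2/3}`). -/
theorem isoInput_of_federer (h : Federer1969_isoperimetricUnionBalls) {r : ℝ} (hr : 1 / 2 ≤ r) :
    IsoInput r (1 / (4 * r ^ 2)) := by
  intro N x hx
  have hr0 : 0 < r := lt_of_lt_of_le (by norm_num) hr
  have hπ : 0 < π := pi_pos
  -- Federer's corollary with `ρ = 1/2`
  have hsep : Pairwise fun i j => 2 * (1 / 2 : ℝ) ≤ dist (x i) (x j) := by
    intro i j hij; have := hx hij; linarith
  have hF := Federer1969_isoperimetricUnionBalls.sphereFraction_sum_cube h x (by norm_num) hr hsep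
  simp only [Fintype.card_fin] at hF
  -- rewrite the sum in the venture's vocabulary
  have hS : ∑ i, sphereFraction (exposedDirections x r i) = ∑ i, exposedFraction x r i := rfl
  rw [hS] at hF
  set S := ∑ i, exposedFraction x r i with hSdef
  have hS0 : 0 ≤ S := Finset.sum_nonneg fun i _ => exposedFraction_nonneg x r i
  set T := 4 * π * r ^ 2 * S with hT
  have hT0 : 0 ≤ T := by positivity
  -- `T³ ≥ π³ N²`, hence `T ≥ π N^{2/3}`
  have hcube : (π * (N : ℝ) ^ ((2 : ℝ) / 3)) ^ 3 ≤ T ^ 3 := by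
    have hN23 : ((N : ℝ) ^ ((2 : ℝ) / 3)) ^ 3 = (N : ℝ) ^ 2 := by
      rw [← Real.rpow_natCast, ← Real.rpow_mul (Nat.cast_nonneg N)]; norm_num
    calc (π * (N : ℝ) ^ ((2 : ℝ) / 3)) ^ 3 = π ^ 3 * (N : ℝ) ^ 2 := by rw [mul_pow, hN23]
      _ = 36 * π * ((N : ℝ) * (4 / 3 * π * (1 / 2 : ℝ) ^ 3)) ^ 2 := by ring
      _ ≤ T ^ 3 := hF
  have hTge : π * (N : ℝ) ^ ((2 : ℝ) / 3) ≤ T := by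
    by_contra hlt
    have hlt' : T < π * (N : ℝ) ^ ((2 : ℝ) / 3) := not_le.1 hlt
    have : T ^ 3 < (π * (N : ℝ) ^ ((2 : ℝ) / 3)) ^ 3 :=
      pow_lt_pow_left₀ hlt' hT0 (by norm_num)
    linarith
  -- divide by `4π r²`
  have h4 : 0 < 4 * π * r ^ 2 := by positivity
  calc 1 / (4 * r ^ 2) * (N : ℝ) ^ ((2 : ℝ) / 3) = (π * (N : ℝ) ^ ((2 : ℝ) / 3)) / (4 * π * r ^ 2) := by
        field_simp
    _ ≤ T / (4 * π * r ^ 2) := div_le_div_of_nonneg_right hTge h4.le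
    _ = S := by rw [hT]; field_simp

/-- At probing radius `1`: `IsoInput 1 (1/4)` from Federer's inequality. -/
theorem isoInput_one_of_federer (h : Federer1969_isoperimetricUnionBalls) : IsoInput 1 (1 / 4) := by
  have := isoInput_of_federer h (r := 1) (by norm_num)
  simpa using this

/-- **The Lévy rung on classical facts only**: Lévy–Schmidt + Federer ⇒ `SurfaceBound (167/100)`,
i.e. every packing of `N ≥ 2` diameter-`1` balls in `ℝ³` has fewer than `6N - 1.67 N^{2/3}`
contacts. Trust base: the two Literature named facts; everything else kernel-checked. -/
theorem surfaceBound_levy_classical (hLevy : Schmidt1948_sphericalIsoperimetric)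
    (hFed : Federer1969_isoperimetricUnionBalls) : SurfaceBound (167 / 100) :=
  surfaceBound_levy_rung hLevy (isoInput_one_of_federer hFed)

/-- **H1 on Federer**: the cell's certified cap table at probing radius `1` (input `(L)`, CELL5 +
Lévy) and Federer's inequality give `SurfaceBound (23/10)`. -/
theorem surfaceBound_H1_classical (hL : LevyCapInput 1 FH1)
    (hFed : Federer1969_isoperimetricUnionBalls) : SurfaceBound (23 / 10) :=
  surfaceBound_H1_rung hL (isoInput_one_of_federer hFed)

/-- Bezdek–Reid's printed `0.926` follows from the two classical facts as well. -/
theorem bezdekReidBound_classical (hLevy : Schmidt1948_sphericalIsoperimetric)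
    (hFed : Federer1969_isoperimetricUnionBalls) : BezdekReidBound :=
  (surfaceBound_levy_classical hLevy hFed).anti (by norm_num)

/-! ## Unconditional corollaries (appended after the Lévy–Schmidt inequality was PROVED in the tree)

`Literature.Geometry.DiscreteGeometry.Schmidt1948_sphericalIsoperimetric_holds`
(`SphericalIsoperimetricProof.lean`, Benyamini two-point symmetrization after Schneider 2022,
Thm 3.4.1) discharges the hypothesis `Schmidt1948_sphericalIsoperimetric` of the results above and
of `LevyCap` / `LevyHeadline` / `BezdekConjecture`. What remains named: Federer's inequality (for
the surface bounds) — nothing for Bezdek's Conjecture 3.5. -/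

/-- **`(L)` at probing radius `1`, unconditionally**: the Lévy cap table `fLevy2 k / 16π`. -/
theorem levyCapInput_one_holds : LevyCapInput 1 (fun k => Inequalities.fLevy2 k / (16 * π)) :=
  levyCapInput_one Schmidt1948_sphericalIsoperimetric_holds

/-- **Bezdek's Conjecture 3.5 (DCG 48, 2012), covering form — PROVED**: for `M` unit vectors with
pairwise angles `≥ π/3`, the open `π/3`-caps about them cover at least the fraction `M/12` of the
sphere. -/
theorem bezdek_conjecture35_covering_holds :
    ∀ (M : ℕ) (u : Fin M → EuclideanSpace ℝ (Fin 3)), (∀ m, ‖u m‖ = 1) →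
      (Pairwise fun m l => π / 3 ≤ InnerProductGeometry.angle (u m) (u l)) →
      (M : ℝ) / 12 ≤ sphereFraction (⋃ m, sphOpenCap (u m) (π / 3)) :=
  bezdek_conjecture35_covering Schmidt1948_sphericalIsoperimetric_holds

/-- **Bezdek's Conjecture 3.5 (DCG 48, 2012), as printed — PROVED**: if the open `π/6`-caps about
`M` unit vectors are pairwise disjoint, then the sum of their fractions is at most
`6(1 - √3/2)` times the fraction covered by the `π/3`-caps. -/
theorem bezdek_conjecture35_asPrinted_holds :
    ∀ (M : ℕ) (u : Fin M → EuclideanSpace ℝ (Fin 3)), (∀ m, ‖u m‖ = 1) →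
      (Pairwise fun m l => Disjoint (sphOpenCap (u m) (π / 6)) (sphOpenCap (u l) (π / 6))) →
      ∑ m, sphereFraction (sphOpenCap (u m) (π / 6)) ≤
        6 * (1 - Real.sqrt 3 / 2) * sphereFraction (⋃ m, sphOpenCap (u m) (π / 3)) :=
  bezdek_conjecture35_asPrinted Schmidt1948_sphericalIsoperimetric_holds

/-- **The Lévy rung on Federer alone**: `C(x) < 6N - 1.67 N^{2/3}` for every packing of `N ≥ 2`
diameter-`1` balls in `ℝ³`, conditional only on the named fact
`Federer1969_isoperimetricUnionBalls`. -/
theorem surfaceBound_levy_of_federer (hFed : Federer1969_isoperimetricUnionBalls) :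
    SurfaceBound (167 / 100) :=
  surfaceBound_levy_classical Schmidt1948_sphericalIsoperimetric_holds hFed

/-- Bezdek–Reid's printed `0.926`, conditional only on Federer's inequality. -/
theorem bezdekReidBound_of_federer (hFed : Federer1969_isoperimetricUnionBalls) : BezdekReidBound :=
  bezdekReidBound_classical Schmidt1948_sphericalIsoperimetric_holds hFed

end Summit.Ventures.Crystal3D

end
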